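import Mathlib
import Literature.MathematicalPhysics.QuantumFieldTheory.MagnenRivasseauSeneor1993.MRS93TruncatedGauge
import HarnessLib

/-!
# Magnen–Rivasseau–Sénéor, *Construction of YM₄ with an infrared cutoff* (CMP 155, 1993), §IV (IV.4), first line: the
# decomposition of the curvature of `A′_s + B′_l` into background-covariant derivatives of the small field, the small-field
# commutator and the background curvature — the pointwise su(2) identity, kernel-checked

statement-level skeleton of published theorems with citation tags; proofs where landed; nothing here is a claim about the
Yang–Mills mass gap, about continuum YM₄ on T⁴, or about the Clay problem

**Citation header (reproduction of PUBLISHED work).** J. Magnen, V. Rivasseau, R. Sénéor, *Construction of YM₄ with an infrared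
cutoff*, Commun. Math. Phys. **155** (1993) 325–383 [MagnenRivasseauSeneor1993], §IV p.354 [PDF 30] tl.43 and display (IV.4) (page image
`run/shared/lean/pub/pub-balaban-gaps/pub-balaban-gaps-mrs-lit-2/g4/renders/p30_crop_r4300-5700_s2.png`), (IV.5) p.355 [PDF 31]
(`p31_crop_r250-900_s2.png`); conventions (II.1) p.328. Cell pub-balaban-gaps (YM blitz, track G3), seat mrs-lit-2 (gen 4); companion record
`run/shared/lean/pub/pub-balaban-gaps/g3/MRS-AS-PRINTED-estimates.md` §7 (display concordance: (IV.4) was the one checkable algebraic display of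
Sect. IV left untyped). Imports `MRS93TruncatedGauge.lean` (mrs-lit-1) for the printed su(2) conventions: `TruncatedGauge.bracket`
(«[A^a_μ, A^b_ν] = ε^c_{ab} A^a_μ A^b_ν», p.328) = the cross product on `ℝ³`.

**What the paper prints (verbatim, from the page image).**
* (II.1) p.328: «F_μν = (∂_μA_ν − ∂_νA_μ) − λ[A_μ, A_ν]»; p.328 tl.27: «the covariant derivative is D_μ = ∂_μ − λ[A_μ, ·]».
* p.354 tl.43 and (IV.4): «The Yang-Mills action is therefore decomposed as:
  F_μν(A′_s + B′_l) = D_μ(B′_l)·(A′_s)_ν − D_ν(B′_l)·(A′_s)_μ − λ[(A′_s)_μ, (A′_s)_ν] + F_μν(B′_l)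
                  = (∇_B̄′_l)_μ(A′_s)_ν − (∇_B̄′_l)_ν(A′_s)_μ − λ[(A′_s)_μ, (A′_s)_ν] + F_μν(B′_l) + G_μν(B′_l, A′_s),  (IV.4)»
  with (IV.5) p.355: «G_{μ,ν}(A′_s, B′_l) ≡ −(Σ_i λ[(1 − κ_i) ∗ (B′_l)_μ, κ^i ∗ (A′_s)_ν] − (μ → ν))».

**What this file PROVES (kernel; zero `sorry`, zero named facts).** The FIRST line of (IV.4) as a pointwise identity in su(2) ≅ ℝ³:
at a point `x`, with the values `A_μ, B_μ ∈ ℝ³` and the values of the derivatives `∂_μA_ν, ∂_μB_ν ∈ ℝ³` as free data (the identity is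
linear in the derivatives, so nothing about differentiation is needed beyond `∂_μ(A + B)_ν = ∂_μA_ν + ∂_μB_ν`, which is how the data of
`A + B` are formed): `curvature_add` — `F_μν(A + B) = D_μ(B)A_ν − D_ν(B)A_μ − λ[A_μ, A_ν] + F_μν(B)` for every `μ, ν`, every `λ`,
with `F` = (II.1) (`curvature`) and `D_μ(B)X = ∂_μX − λ[B_μ, X]` (`covDeriv`). Also `curvature_antisymm` (`F_νμ = −F_μν`).

**What is NOT claimed.** The second line of (IV.4) and (IV.5) (the cut-off covariant derivative `∇_B` of (II.50) involves the convolutions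
`κ_j ∗`, `κ^j ∗`; only quoted); (IV.1)–(IV.3), (IV.6)–(IV.16); anything analytic. Nothing here bears on Bałaban's papers; nothing is
continuum YM₄ on T⁴, nothing lifts the infrared cutoff, nothing is Clay.
-/

namespace Literature.MathematicalPhysics.QuantumFieldTheory.MagnenRivasseauSeneor1993

namespace SectIV

open TruncatedGauge

/-- Pointwise data of a Lie-algebra valued vector field at one point: the values `val μ = A_μ(x) ∈ su(2) ≅ ℝ³` and the values of
the first derivatives `der μ ν = ∂_μA_ν(x)`. [cite: MagnenRivasseauSeneor1993, §II.A (II.1) p.328] -/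
structure FieldJet where
  /-- `A_μ(x)`, colour components. -/
  val : Fin 4 → Fin 3 → ℝ
  /-- `∂_μ A_ν(x)`, colour components. -/
  der : Fin 4 → Fin 4 → Fin 3 → ℝ

/-- The jet of `A + B` (values and derivatives add). [cite: MagnenRivasseauSeneor1993, §IV (IV.4) p.354] -/
def FieldJet.add (A B : FieldJet) : FieldJet where
  val μ := A.val μ + B.val μ
  der μ ν := A.der μ ν + B.der μ ν

/-- (II.1) p.328: «F_μν = (∂_μA_ν − ∂_νA_μ) − λ[A_μ, A_ν]», colour components at a point.
[cite: MagnenRivasseauSeneor1993, §II.A (II.1) p.328] -/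
def curvature (lam : ℝ) (A : FieldJet) (μ ν : Fin 4) : Fin 3 → ℝ :=
  A.der μ ν - A.der ν μ - lam • bracket (A.val μ) (A.val ν)

/-- The background covariant derivative of the small field, «D_μ = ∂_μ − λ[B_μ, ·]» (p.328 tl.27) applied to `A_ν`:
`D_μ(B)·A_ν = ∂_μA_ν − λ[B_μ, A_ν]` at a point. [cite: MagnenRivasseauSeneor1993, §II.A p.328; §IV (IV.4) p.354] -/
def covDeriv (lam : ℝ) (B A : FieldJet) (μ ν : Fin 4) : Fin 3 → ℝ :=
  A.der μ ν - lam • bracket (B.val μ) (A.val ν)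

/-- `F_νμ = −F_μν`. [cite: MagnenRivasseauSeneor1993, §II.A (II.1) p.328] -/
theorem curvature_antisymm (lam : ℝ) (A : FieldJet) (μ ν : Fin 4) :
    curvature lam A ν μ = -curvature lam A μ ν := by
  unfold curvature
  rw [bracket_swap (A.val μ) (A.val ν)]
  ext a
  simp
  ring

/-- **(IV.4), first line** p.354 [PDF 30]: «F_μν(A′_s + B′_l) = D_μ(B′_l)·(A′_s)_ν − D_ν(B′_l)·(A′_s)_μ − λ[(A′_s)_μ, (A′_s)_ν] + F_μν(B′_l)»
— for every coupling `λ`, every pair of indices and all pointwise data (bilinearity and antisymmetry of the su(2) bracket).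
[cite: MagnenRivasseauSeneor1993, §IV (IV.4) p.354] -/
theorem curvature_add (lam : ℝ) (A B : FieldJet) (μ ν : Fin 4) :
    curvature lam (A.add B) μ ν =
      covDeriv lam B A μ ν - covDeriv lam B A ν μ - lam • bracket (A.val μ) (A.val ν) + curvature lam B μ ν := by
  unfold curvature covDeriv FieldJet.add
  simp only [bracket_eq_crossProduct, map_add, LinearMap.add_apply]
  rw [← neg_cross (A.val μ) (B.val ν)]
  ext a
  simp only [Pi.add_apply, Pi.sub_apply, Pi.smul_apply, Pi.neg_apply, smul_eq_mul]
  ring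

end SectIV

end Literature.MathematicalPhysics.QuantumFieldTheory.MagnenRivasseauSeneor1993
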